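import Literature.Probability.RandomPlanarGeometry.HexSAWStripWidthTwoContactVariance
import HarnessLib

/-!
# The width-two strip at criticality: a weak law for the surface contacts with an explicit `1/n` rate —
# `n·P_n(|#top/n − (3 − √2)/4| ≥ ε) ≤ σ₂²/ε² + o(1)`, `σ₂² = (96 − 67√2)/8` (module «WIDTH-TWO CONTACT CHEBYSHEV RATE»)

Topic `Literature/Probability/RandomPlanarGeometry` (continues «WIDTH-TWO CONTACT VARIANCE RATE» — `W2.varTopTwo`, `W2.meanTopTwo`,
`W2.tendsto_varTopTwo_div_hatLen`, `W2.tendsto_meanTopTwo_sub_linear`, `W2.limTwo_pos` — and restates it in the vocabulary of «CONTACT-LLN» #750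
`HexSAWStripBridgeContactLLN.lean` (`widthTwo_contacts_deviation`: the same deviation mass `→ 0`, without a rate): sums of the critical weights
`wD 2 y₂ l = x_c^{|l|−1} y₂^{#top}` over the bridges `l ∈ LUset 2 (2k+1) (hatLen k a b) a b`).  Lane «pcv-sawmu» (CriticalPhenomena venture), a-p2 g27.
Setting: W. Feller I (1968) IX.6 (Chebyshev), XIII.6 (moments of the number of renewals); H. Duminil-Copin, A. Hammond, CMP 324 (2013) §2.2.
Nothing below is printed.

## What is proved (namespace `…SAW.HV.W2`, `y₂ = stripYT 2`, `n_k = hatLen k a b = 2k + χ_a − χ_b`)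

* `sum_sq_sub_mul_wD_two` (`Σ(#top − m)²wD = Ĉ²_D − 2mĈ_D + m²D̂` for any centre `m`), `sum_sq_sub_mean_wD_two` (`= D̂·varTopTwo` at the mean),
  `sum_filter_wD_le_sq_div_two` (Chebyshev on the finite weighted sum), `eventually_hatD_two_pos`, `tendsto_meanTopTwo_sub_div_hatLen`
  (`(meanTopTwo − θ₂ n_k)/n_k → 0`).
* ★★★ **`widthTwo_contacts_deviation_rate`** — for every `ε > 0`, all `a, b` and every `η > σ₂²/ε²`, eventually
  `n_k · (Σ_{bridges a→b with n_k steps, |#top/n_k − (3 − √2)/4| ≥ ε} wD) / D̂(k)_{ab} ≤ η`: the deviation probability of #750 is `O(1/n)` with the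
  explicit constant `σ₂²/ε² = (96 − 67√2)/(8ε²)`.

Label: LANE THEOREM (own result of lane «pcv-sawmu», a-p2 g27, 2026-08-28; not in print).  NOT claimed: exponential (large-deviation) bounds, a CLT.
-/

noncomputable section

open Finset Filter Topology Matrix Literature.Probability.LatticeModels Literature.Probability.Percolation Literature.Analysis

namespace Literature.Probability.RandomPlanarGeometry.SAW

namespace HV

namespace W2

/-! ## Chebyshev with the linear variance law: an explicit `1/n` rate for the weak law of the surface contacts -/

/-- The centred second moment of the contact count over the bridges `a → b` of hat index `k` is `Ĉ²_D − 2mĈ_D + m²D̂` for any centre `m`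
(the three hat sums are sums over the same finite set of bridges). [cite: Feller1968, XIII.6; lane plumbing] -/
theorem sum_sq_sub_mul_wD_two (y : ℝ) (k : ℕ) (a b : Fin (2 * 2)) (m : ℝ) :
    ∑ l ∈ LUset 2 (2 * k + 1) (hatLen k a b) (a : ℕ) (b : ℕ), ((topCnt 2 l.tail : ℝ) - m) ^ 2 * wD 2 y l
      = hatC2D y k a b - 2 * m * hatCD y k a b + m ^ 2 * hatD 2 y k a b := by
  have hD : hatD 2 y k a b = ∑ l ∈ LUset 2 (2 * k + 1) (hatLen k a b) (a : ℕ) (b : ℕ), wD 2 y l := rfl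
  rw [hD, hatC2D, hatCD, Matrix.of_apply, Matrix.of_apply, Finset.mul_sum, Finset.mul_sum, ← Finset.sum_sub_distrib, ← Finset.sum_add_distrib]
  exact Finset.sum_congr rfl fun l _ => by ring

/-- With the mean as centre: `Σ_{bridges} (#top − meanTopTwo)²·wD = D̂·varTopTwo` (at `y₂`, whenever `D̂(k)_{ab} ≠ 0`). [cite: Feller1968, XIII.6; lane plumbing] -/
theorem sum_sq_sub_mean_wD_two {k : ℕ} {a b : Fin (2 * 2)} (hD : hatD 2 (stripYT 2) k a b ≠ 0) :
    ∑ l ∈ LUset 2 (2 * k + 1) (hatLen k a b) (a : ℕ) (b : ℕ), ((topCnt 2 l.tail : ℝ) - meanTopTwo k a b) ^ 2 * wD 2 (stripYT 2) l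
      = hatD 2 (stripYT 2) k a b * varTopTwo k a b := by
  rw [sum_sq_sub_mul_wD_two, varTopTwo, meanTopTwo]
  field_simp
  ring

/-- Chebyshev on the finite weighted sum: the `wD`-mass of the bridges with `|#top − m| ≥ c` is at most `Σ(#top − m)²wD / c²` (`c > 0`, `y ≥ 0`).
[cite: Feller1968, IX.6 (Chebyshev's inequality); lane plumbing] -/
theorem sum_filter_wD_le_sq_div_two {y : ℝ} (hy : 0 ≤ y) (k : ℕ) (a b : Fin (2 * 2)) (m : ℝ) {c : ℝ} (hc : 0 < c) :
    ∑ l ∈ (LUset 2 (2 * k + 1) (hatLen k a b) (a : ℕ) (b : ℕ)).filter (fun l => c ≤ |(topCnt 2 l.tail : ℝ) - m|), wD 2 y l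
      ≤ (∑ l ∈ LUset 2 (2 * k + 1) (hatLen k a b) (a : ℕ) (b : ℕ), ((topCnt 2 l.tail : ℝ) - m) ^ 2 * wD 2 y l) / c ^ 2 := by
  set S := LUset 2 (2 * k + 1) (hatLen k a b) (a : ℕ) (b : ℕ) with hS
  rw [le_div_iff₀ (by positivity), Finset.sum_mul]
  calc ∑ l ∈ S.filter (fun l => c ≤ |(topCnt 2 l.tail : ℝ) - m|), wD 2 y l * c ^ 2
      ≤ ∑ l ∈ S.filter (fun l => c ≤ |(topCnt 2 l.tail : ℝ) - m|), ((topCnt 2 l.tail : ℝ) - m) ^ 2 * wD 2 y l := by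
        refine Finset.sum_le_sum fun l hl => ?_
        rw [Finset.mem_filter] at hl
        have hw := wD_nonneg 2 hy l
        have h2 : c ^ 2 ≤ ((topCnt 2 l.tail : ℝ) - m) ^ 2 := by
          calc c ^ 2 ≤ |(topCnt 2 l.tail : ℝ) - m| ^ 2 := pow_le_pow_left₀ hc.le hl.2 2
            _ = ((topCnt 2 l.tail : ℝ) - m) ^ 2 := sq_abs _
        nlinarith
    _ ≤ ∑ l ∈ S, ((topCnt 2 l.tail : ℝ) - m) ^ 2 * wD 2 y l :=
        Finset.sum_le_sum_of_subset_of_nonneg (Finset.filter_subset _ _) fun l _ _ => mul_nonneg (sq_nonneg _) (wD_nonneg 2 hy l)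

/-- `D̂(k)_{ab} > 0` eventually (it converges to `limTwo_{ab} > 0`). [cite: Feller1968, XIII.10; lane plumbing] -/
theorem eventually_hatD_two_pos (a b : Fin (2 * 2)) : ∀ᶠ k : ℕ in atTop, 0 < hatD 2 (stripYT 2) k a b :=
  (tendsto_hatD_two a b).eventually (eventually_gt_nhds (limTwo_pos a b))

/-- The centring error per step vanishes: `(meanTopTwo k a b − θ₂·n_k)/n_k → 0` (`n_k = hatLen k a b`, `θ₂ = (3 − √2)/4`; the numerator converges).
[cite: Feller1968, XIII.6; lane plumbing] -/
theorem tendsto_meanTopTwo_sub_div_hatLen (a b : Fin (2 * 2)) :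
    Tendsto (fun k : ℕ => (meanTopTwo k a b - (3 - Real.sqrt 2) / 4 * ((hatLen k a b : ℤ) : ℝ)) / ((hatLen k a b : ℤ) : ℝ)) atTop (𝓝 0) := by
  set c : ℝ := ((lchi a : ℤ) : ℝ) - ((lchi b : ℤ) : ℝ) with hc
  have hL : ∀ k : ℕ, ((hatLen k a b : ℤ) : ℝ) = 2 * (k : ℝ) + c := fun k => by rw [hc, hatLen]; push_cast; ring
  have hden : Tendsto (fun k : ℕ => ((hatLen k a b : ℤ) : ℝ)) atTop atTop := by
    simp_rw [hL]
    exact (tendsto_natCast_atTop_atTop.const_mul_atTop two_pos).atTop_add tendsto_const_nhds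
  -- the numerator at index `k+1` converges
  have hnum : Tendsto (fun k : ℕ => meanTopTwo (k + 1) a b - (3 - Real.sqrt 2) / 4 * ((hatLen (k + 1) a b : ℤ) : ℝ)) atTop
      (𝓝 (interceptCTwo a b / limTwo a b - (3 - Real.sqrt 2) / 4 * c)) := by
    have t := (tendsto_meanTopTwo_sub_linear a b).sub_const ((3 - Real.sqrt 2) / 4 * c)
    refine t.congr fun k => ?_
    rw [hL (k + 1)]
    push_cast
    ring
  have h1 : Tendsto (fun k : ℕ => (meanTopTwo (k + 1) a b - (3 - Real.sqrt 2) / 4 * ((hatLen (k + 1) a b : ℤ) : ℝ))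
      / ((hatLen (k + 1) a b : ℤ) : ℝ)) atTop (𝓝 0) :=
    hnum.div_atTop (hden.comp (tendsto_add_atTop_nat 1))
  exact (tendsto_add_atTop_iff_nat 1).1 h1

/-- ★★★ **WEAK LAW WITH AN EXPLICIT `1/n` RATE for the surface contacts of the critical width-two strip**: for every `ε > 0`, all end levels `a, b` and every
`η > σ₂²/ε²` (`σ₂² = (96 − 67√2)/8`), eventually in the hat index `k` (with `n = hatLen k a b` steps)
`n · (Σ_{bridges a→b with n steps, |#top/n − (3 − √2)/4| ≥ ε} x_c^{n} y₂^{#top}) / D̂(k)_{ab} ≤ η` — Chebyshev with the LINEAR VARIANCE LAW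
(«WIDTH-TWO CONTACT VARIANCE RATE») and the order-one mean; sharpens «CONTACT-LLN» #750's `widthTwo_contacts_deviation` (→ 0 without rate).
[cite: Feller1968, XIII.6 and IX.6; DuminilCopinHammond2013, §2.2; lane «pcv-sawmu» a-p2 g27 — own result, not in print] -/
theorem widthTwo_contacts_deviation_rate (a b : Fin (2 * 2)) {ε : ℝ} (hε : 0 < ε) {η : ℝ} (hη : (96 - 67 * Real.sqrt 2) / 8 / ε ^ 2 < η) :
    ∀ᶠ k : ℕ in atTop,
      ((hatLen k a b : ℤ) : ℝ) * (∑ l ∈ (LUset 2 (2 * k + 1) (hatLen k a b) (a : ℕ) (b : ℕ)).filter (fun l =>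
          ε ≤ |(topCnt 2 l.tail : ℝ) / ((hatLen k a b : ℤ) : ℝ) - (3 - Real.sqrt 2) / 4|), wD 2 (stripYT 2) l) /
        hatD 2 (stripYT 2) k a b ≤ η := by
  have hy : 0 < stripYT 2 := stripYT_pos (by norm_num)
  set θ : ℝ := (3 - Real.sqrt 2) / 4 with hθ
  set n : ℕ → ℝ := fun k => ((hatLen k a b : ℤ) : ℝ) with hn
  set β : ℕ → ℝ := fun k => (meanTopTwo k a b - θ * n k) / n k with hβ
  have hv := tendsto_varTopTwo_div_hatLen a b
  have hβ0 : Tendsto β atTop (𝓝 0) := tendsto_meanTopTwo_sub_div_hatLen a b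
  have hden : Tendsto n atTop atTop := by
    have hL : n = fun k : ℕ => 2 * (k : ℝ) + (((lchi a : ℤ) : ℝ) - ((lchi b : ℤ) : ℝ)) := funext fun k => by
      simp only [hn, hatLen]; push_cast; ring
    rw [hL]
    exact (tendsto_natCast_atTop_atTop.const_mul_atTop two_pos).atTop_add tendsto_const_nhds
  -- the bound `g_k = (var_k/n_k)/(ε − |β_k|)² → σ₂²/ε²`
  have hg : Tendsto (fun k : ℕ => (varTopTwo k a b / n k) / (ε - |β k|) ^ 2) atTop (𝓝 ((96 - 67 * Real.sqrt 2) / 8 / (ε - |0|) ^ 2)) := by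
    refine hv.div ((tendsto_const_nhds.sub hβ0.abs).pow 2) ?_
    rw [abs_zero, sub_zero]; positivity
  rw [abs_zero, sub_zero] at hg
  have hEv1 : ∀ᶠ k : ℕ in atTop, (varTopTwo k a b / n k) / (ε - |β k|) ^ 2 < η := hg.eventually (eventually_lt_nhds hη)
  have hEv2 : ∀ᶠ k : ℕ in atTop, |β k| < ε := by
    have := hβ0.abs
    rw [abs_zero] at this
    exact this.eventually (eventually_lt_nhds hε)
  have hEv3 : ∀ᶠ k : ℕ in atTop, 0 < n k := hden.eventually_gt_atTop 0
  filter_upwards [hEv1, hEv2, hEv3, eventually_hatD_two_pos a b] with k h1 h2 h3 hD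
  set m : ℝ := meanTopTwo k a b with hm
  set S := LUset 2 (2 * k + 1) (hatLen k a b) (a : ℕ) (b : ℕ) with hS
  -- the deviation event implies `|#top − m| ≥ (ε − |β_k|)·n_k`
  have hc : 0 < (ε - |β k|) * n k := mul_pos (by linarith) h3
  have hsub : S.filter (fun l => ε ≤ |(topCnt 2 l.tail : ℝ) / n k - θ|) ⊆ S.filter (fun l => (ε - |β k|) * n k ≤ |(topCnt 2 l.tail : ℝ) - m|) := by
    intro l hl
    rw [Finset.mem_filter] at hl ⊢
    refine ⟨hl.1, ?_⟩
    have hnk : n k ≠ 0 := h3.ne'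
    have e1 : (topCnt 2 l.tail : ℝ) - m = n k * ((topCnt 2 l.tail : ℝ) / n k - θ) - n k * β k := by
      simp only [hβ, hm]
      field_simp
      ring
    rw [e1]
    have hA : ε * n k ≤ |n k * ((topCnt 2 l.tail : ℝ) / n k - θ)| := by
      rw [abs_mul, abs_of_pos h3, mul_comm]
      exact mul_le_mul_of_nonneg_left hl.2 h3.le
    have hB : |n k * β k| = n k * |β k| := by rw [abs_mul, abs_of_pos h3]
    have := abs_sub_abs_le_abs_sub (n k * ((topCnt 2 l.tail : ℝ) / n k - θ)) (n k * β k)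
    nlinarith [hA, hB, this]
  have hcheb := sum_filter_wD_le_sq_div_two hy.le k a b m hc
  rw [sum_sq_sub_mean_wD_two hD.ne'] at hcheb
  have hmono : ∑ l ∈ S.filter (fun l => ε ≤ |(topCnt 2 l.tail : ℝ) / n k - θ|), wD 2 (stripYT 2) l
      ≤ ∑ l ∈ S.filter (fun l => (ε - |β k|) * n k ≤ |(topCnt 2 l.tail : ℝ) - m|), wD 2 (stripYT 2) l :=
    Finset.sum_le_sum_of_subset_of_nonneg hsub fun l _ _ => wD_nonneg 2 hy.le l
  -- assemble: n · P ≤ n · var·D̂/((ε−|β|)² n² D̂) = (var/n)/(ε − |β|)² < η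
  have hkey : n k * (∑ l ∈ S.filter (fun l => ε ≤ |(topCnt 2 l.tail : ℝ) / n k - θ|), wD 2 (stripYT 2) l) / hatD 2 (stripYT 2) k a b
      ≤ (varTopTwo k a b / n k) / (ε - |β k|) ^ 2 := by
    have hstep : n k * (∑ l ∈ S.filter (fun l => ε ≤ |(topCnt 2 l.tail : ℝ) / n k - θ|), wD 2 (stripYT 2) l) / hatD 2 (stripYT 2) k a b
        ≤ n k * (hatD 2 (stripYT 2) k a b * varTopTwo k a b / ((ε - |β k|) * n k) ^ 2) / hatD 2 (stripYT 2) k a b := by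
      refine div_le_div_of_nonneg_right (mul_le_mul_of_nonneg_left (hmono.trans hcheb) h3.le) hD.le
    refine hstep.trans (le_of_eq ?_)
    field_simp
  exact hkey.trans h1.le

end W2

end HV

end Literature.Probability.RandomPlanarGeometry.SAW
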